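import Summits.ValiantsHypothesis.ValiantsHypothesis.Theses.DecompCycle1
import Summits.ValiantsHypothesis.ValiantsHypothesis.Theses.RyserTripartition
import Summits.ValiantsHypothesis.ValiantsHypothesis.Theorems.BlockLaplaceLift
import Summits.ValiantsHypothesis.ValiantsHypothesis.Theorems.ColumnSubsetDP
import Summits.ValiantsHypothesis.ValiantsHypothesis.Theorems.RowPartitionRank
import Summits.ValiantsHypothesis.ValiantsHypothesis.Theorems.RyserFormula
import Summits.ValiantsHypothesis.ValiantsHypothesis.Theorems.RowSmlDepthFour
import HarnessLib

/-!
# SmThreshold — exponential syntactically-multilinear hardness of `per` suffices for `VP ≠ VNP`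
(decomposition workshop `decomp-valiant`, lens 6 «restricted-models lifting axis», gen 3; Theses layer
of the node `SmThreshold` landed as theorems; supports `RyserTripartition.MultilinearRyserOptimal`
(stmt-ValiantsHypothesis-7161), `DecompCycle1.PerNotSmVP` (stmt-23661) and the lifting residual
`DecompCycle1.TameOrSmLift` (stmt-23662))

Threshold dial `θ = 2/c` on the syntactically multilinear (sm) axis (`c` = block size of the block
Laplace self-reduction of `per_(mc)` into `m` blocks):

* `PerSmHardExp c` (`A_c`): every sm circuit for `per_(mc)` has size `> a (m+1)^a 4^m`, for every `a`,
  for some `m` (i.o.) — exponential sm hardness at rate `4^(n/c)`; `PerSmExpHard := ∃ c, A_c`.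
* `SmSubexpLift c` (`B_c`): `VP_ℂ = VNP_ℂ ⟹` sm circuits of size `≤ a (m+1)^a 4^m` for `per_(mc)` —
  PROVED for every `c` (`smSubexpLift_holds`, from
  `Theorems.BlockLaplaceLift.exists_smCircuit_perPoly_of_VP_eq_VNP`).
* `closes_at : A_c → B_c → VP_ℂ ≠ VNP_ℂ`, hence `closes : PerSmExpHard → ValiantsHypothesis`:
  an exponential lower bound for SYNTACTICALLY MULTILINEAR circuits computing the permanent, at any
  one rate `2^((2/c) n)·ω(poly(n))` along `n ≡ 0 (mod c)`, implies Valiant's hypothesis.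
* `vh_of_multilinearRyserOptimal : RyserTripartition.MultilinearRyserOptimal → ValiantsHypothesis` —
  the registered crux "Ryser is optimal among sm circuits" (stmt-7161) is SUFFICIENT for the summit
  (it gives `A_3`, `perSmHardExp_of_multilinearRyserOptimal`).
* Comparisons: `A_c ⟹ PerNotSmVP` (`perNotSmVP_of_perSmHardExp`); the gen-2 residual disjunct
  `SmLiftPer` implies every `B_c` (`smSubexpLift_of_polyLift`); `B_c` is vacuous under `S`.

* LOW RUNGS DECIDED (rev 2): `A_0`, `A_1`, `A_2` are FALSE in the kernel — the column-subset DP is a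
  syntactically multilinear circuit of size `2(n+1)2^n` (`Theorems.ColumnSubsetDP`); hence
  `PerSmExpHard ↔ ∃ c ≥ 3, A_c` (`perSmExpHard_iff_three_le`).
* DEPTH-3 SLICE DECIDED (rev 3, §7): the row-local `ΣΠ` (depth-3 row-set-multilinear) slice
  `A^ΣΠ_c` of `A_c` holds iff `c ≥ 3` (`perRowLocalHardExp_iff_three_le`) — TRUE side: the
  flattening rank `2^n ≤ (n+1)·s` (`Theorems.RowPartitionRank`, Nisan–Wigderson); FALSE side: Ryser's
  formula, `s = 2^n` (`Theorems.RyserFormula`). First A-SIDE theorem of the dial; and the leaf count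
  `≥ C(n,|B|)` of every row-block self-reduction (`RowPartitionRank…blockLocal`) shows block
  identities cannot drive the dial to `θ → 0`. NEXT RUNG (rev 4): the OPEN depth-4 row-sml statement
  `RowSmlDepthFour.PerRowSmlDepthFourHardExp c` implies `A^ΣΠ_c` (`three_le_of_perRowSmlDepthFourHardExp`).

HONEST FRAMING: `A_c` (`c ≥ 3`) and `MultilinearRyserOptimal` are OPEN and NOT weaker than the
summit; `A_c` for `c ≤ 2` is refuted (in print by Ryser's formula; in the tree by the DP). Nothing here is evidence for
`VP ≠ VNP`; the content is the proved lifting side `B_c` (block Laplace expansion +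
Limaye–Srinivasan–Tavenas Lemma 12 + Valiant's criterion) and elementary growth arithmetic.

## References

* [LimayeSrinivasanTavenas2025] N. Limaye, S. Srinivasan, S. Tavenas, J. ACM 72 (2025), Lemma 12.
* [Burgisser2000] P. Bürgisser, *Completeness and Reduction in Algebraic Complexity Theory*, Prop. 2.20.
* [RazYehudayoff2008] R. Raz, A. Yehudayoff, Comput. Complexity 17 (2008), §1.4.
* [RazShpilkaYehudayoff2008] R. Raz, A. Shpilka, A. Yehudayoff, SIAM J. Comput. 38 (2008), Thm 1.1.
* [AlonKumarVolk2020] N. Alon, M. Kumar, B. L. Volk, Combinatorica 40 (2020), Thm 1.2.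
* [Ryser1963] H. J. Ryser, *Combinatorial Mathematics*, Carus Monograph 14 (1963), Ch. 2 §5, Thm. 4.1.
* [NisanWigderson1996] N. Nisan, A. Wigderson, Comput. Complexity 6 (1996/97) 217–234, §3.
-/

namespace Summit.ValiantsHypothesis.ValiantsHypothesis.Theorems.SmThreshold

open Literature.Computability.AlgebraicComplexity
open Summit.ValiantsHypothesis.ValiantsHypothesis.Theses.DecompCycle1 (PerNotSmVP TameOrSmLift TamePer)
open Summit.ValiantsHypothesis.ValiantsHypothesis.Theses.RyserTripartition (MultilinearRyserOptimal)

/-! ## §1 Pieces (the threshold dial `θ = 2/c` on the syntactically multilinear axis) -/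

/-- PIECE `A_c` (threshold `θ = 2/c`; the OPEN piece for `c ≥ 3`) — EXPONENTIAL sm hardness of the
permanent at rate `4^(n/c)`: for every polynomial budget `a` there is a block count `m` such that
every fan-in-two syntactically multilinear circuit over `ℂ` computing `per_(mc)` has MORE than
`a (m+1)^a · 4^m` gates (`= 2^((2/c)·n) · poly(n)` at `n = mc`).
TAGS. `c ∈ {0,1,2}`: DEAD — refuted in print by Ryser's formula, an sm ΣΠΣ expression of size
`O(n² 2ⁿ) ≤ a (m+1)^a 4^m` [Ryser 1963; tree identity `Literature.Combinatorics.Enumerative.RyserFormula`]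
(its typing as an `ArithCircuit` is a routine ATTACKABLE leaf, not done here). `c ≥ 3`: UNDECIDED,
SUFFICIENT, NOT WEAKER — `A_c ⟹ S` (`closes_at` with the PROVED `B_c`), `A_c ⟹ PerNotSmVP`
(`perNotSmVP_of_perSmHardExp`), `MultilinearRyserOptimal ⟹ A_c` (`perSmHardExp_of_multilinearRyserOptimal`,
registered crux stmt-ValiantsHypothesis-7161, refuter verdict "open both ways"); whether `S ⟹ A_c` is
unknown. STATED TEST (UNDECIDED): exhibit, for some `δ > 0`, syntactically multilinear circuits for
`per_n` over `ℂ` of size `2^((1-δ) n)` — this refutes `A_c` for every `c < 2/(1-δ)` and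
`MultilinearRyserOptimal`; no algebraic circuit for the permanent POLYNOMIAL below Ryser/Glynn
`2ⁿ·poly(n)` is known over characteristic `0` (the `2^(n-Ω(√(n/log n)))` algorithms of
Björklund 2012 / Björklund–Kaski–Williams 2019 are tabulation / finite-field algorithms for 0-1 or
bounded-integer inputs, not sm circuits). LEAF: IDEA-NEEDED · BARRIER — the known sm-CIRCUIT lower-bound
engines are polynomial (partial-derivative-matrix rank `Ω(n^(4/3)/log² n)` Raz–Shpilka–Yehudayoff 2008;
unbalancing sets `Ω(n²/log² n)` Alon–Kumar–Volk 2020) and the rank method is capped by full-rank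
polynomials with `O(n³)` sm circuits (Raz–Yehudayoff 2008, tree
`Literature.Barriers.ValiantsHypothesis.not_fullRankMethodProves`); exponential sm lower bounds are
known only for sm FORMULAS / constant depth (Raz 2004, `n^Ω(log n)`; LST 2025) — none for circuits.
INSTRUMENT: COSTUME-CENSUS v4 row C6 (multilinear / set-multilinear world: "poly-loss lifting unknown;
2^O(n) multilinearisation only") — this node makes the loss EXPLICIT: `4^(#blocks)`.
[cite: RazShpilkaYehudayoff2008, Thm 1.1; AlonKumarVolk2020, Thm 1.2; RazYehudayoff2008, §1.4; LimayeSrinivasanTavenas2025, Lemma 12] -/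
def PerSmHardExp (c : ℕ) : Prop :=
  ∀ a : ℕ, ∃ m : ℕ, ∀ P : ArithCircuit ℂ (Fin (m * c) × Fin (m * c)), P.IsFanInTwo →
    IsSyntacticallyMultilinear P → P.Computes (perPoly (Fin (m * c)) ℂ) →
      a * (m + 1) ^ a * 4 ^ m < P.size

/-- PIECE `B_c` (the LIFTING side at threshold `θ = 2/c`) — if `VP_ℂ = VNP_ℂ` then `per_(mc)` has
fan-in-two syntactically multilinear circuits of size `≤ a (m+1)^a · 4^m` for one `a` and all `m`.
TAG: PROVED FOR EVERY `c` — THEOREM `smSubexpLift_holds` (kernel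
`Theorems.BlockLaplaceLift.exists_smCircuit_perPoly_of_VP_eq_VNP`, 0 sorry): block Laplace
expansion of `per_(mc)` into `m` blocks of `c` rows, `per_(mc) = XC_(c,m)(c × c minors)` with the
exact-cover polynomial `XC_(c,m) ∈ VNP` (Valiant's criterion) hence in `VP` under the collapse, and
Limaye–Srinivasan–Tavenas Lemma 12 (set-multilinearisation with loss `2^(#blocks)`, here `4^m` after
the row-subset bookkeeping) at the leaves and at the top. ANSWER TO THE LENS QUESTION "which
structural parameter carries the lifting loss?": the NUMBER OF SET-MULTILINEAR BLOCKS `m = n/c` of the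
self-reduction — the loss is `4^m`, everything else is polynomial under `VP = VNP`. WEAKER than `S`
(true outright). [cite: LimayeSrinivasanTavenas2025, Lemma 12; Burgisser2000, Prop. 2.20; Minc1978, Ch. 2 Thm. 1.2] -/
def SmSubexpLift (c : ℕ) : Prop :=
  VP ℂ = VNP ℂ → ∃ a : ℕ, ∀ m : ℕ, ∃ P : ArithCircuit ℂ (Fin (m * c) × Fin (m * c)), P.IsFanInTwo ∧
    IsSyntacticallyMultilinear P ∧ P.Computes (perPoly (Fin (m * c)) ℂ) ∧
      P.size ≤ a * (m + 1) ^ a * 4 ^ m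

/-- CRUX FORM of the open side — EXPONENTIAL SM HARDNESS OF THE PERMANENT AT SOME RATE: there is a
block size `c` with `A_c`. Equivalent in words: for some `ε > 0`, `per_n` has no syntactically
multilinear circuits of size `2^(ε n)·poly(n)` along `n ≡ 0 (mod c)` (i.o.). SUFFICIENT for `S`
(`closes`); implied by `MultilinearRyserOptimal` (`perSmExpHard_of_multilinearRyserOptimal`); implies
`PerNotSmVP`. UNDECIDED w.r.t. `S` (test as for `A_c`). This is a DISTINCT CONJECTURE in
restricted-model currency (frontier reading: `C ⟹ S` certified, converse unknown, separating
instances `c ≤ 2` refuted in print). [cite: RazYehudayoff2008, §1.4; LimayeSrinivasanTavenas2025, Lemma 12] -/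
@[conjecture] def PerSmExpHard : Prop := ∃ c : ℕ, PerSmHardExp c

/-! ## §2 Deciding theorems -/

/-- The a.e./i.o. clash at one threshold. [folklore] -/
theorem false_of_hard_of_lift {c : ℕ} (hA : PerSmHardExp c) (hB : SmSubexpLift c)
    (heq : VP ℂ = VNP ℂ) : False := by
  obtain ⟨a, ha⟩ := hB heq
  obtain ⟨m, hm⟩ := hA a
  obtain ⟨P, h2, hsm, hf, hs⟩ := ha m
  exact absurd hs (not_le_of_gt (hm P h2 hsm hf))

/-- NODE AT ONE THRESHOLD: `S ⟸ A_c ∧ B_c`. [folklore] -/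
theorem closes_at (c : ℕ) (hA : PerSmHardExp c) (hB : SmSubexpLift c) : _root_.ValiantsHypothesis :=
  perNotPComputableComplex_iff_holds.mp fun hC =>
    false_of_hard_of_lift hA hB (isPComputable_perPoly_complex_iff.mp hC)

/-! ## §3 Comparisons: `A_c` is STRONGER than the parent crux, `B_c` WEAKER than the parent residual -/

/-- Polynomial budgets fit under the exponential threshold: `(mc)^k + k ≤ a (m+1)^a 4^m` with
`a = c^k + k + 1`. [folklore] -/
theorem poly_le_threshold (c k m : ℕ) :
    (m * c) ^ k + k ≤ (c ^ k + k + 1) * (m + 1) ^ (c ^ k + k + 1) * 4 ^ m := by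
  set a := c ^ k + k + 1 with ha
  have h1 : m ^ k ≤ (m + 1) ^ a :=
    (Nat.pow_le_pow_left (Nat.le_succ m) k).trans (Nat.pow_le_pow_right (Nat.succ_pos m) (by omega))
  have h2 : 1 ≤ (m + 1) ^ a := Nat.one_le_pow _ _ (Nat.succ_pos m)
  have h4 : 1 ≤ 4 ^ m := Nat.one_le_pow _ _ (by norm_num)
  calc (m * c) ^ k + k = c ^ k * m ^ k + k := by ring
    _ ≤ c ^ k * (m + 1) ^ a + k * (m + 1) ^ a :=
        Nat.add_le_add (Nat.mul_le_mul_left _ h1) (Nat.le_mul_of_pos_right _ h2)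
    _ = (c ^ k + k) * (m + 1) ^ a * 1 := by ring
    _ ≤ a * (m + 1) ^ a * 4 ^ m :=
        Nat.mul_le_mul (Nat.mul_le_mul_right _ (by omega)) h4

/-- `A_c ⟹ PerNotSmVP` (the gen-2 crux, stmt-ValiantsHypothesis-23661): exponential sm hardness along
`n = mc` implies superpolynomial sm hardness i.o. [folklore] -/
theorem perNotSmVP_of_perSmHardExp {c : ℕ} (hA : PerSmHardExp c) : PerNotSmVP := by
  intro k
  obtain ⟨m, hm⟩ := hA (c ^ k + k + 1)
  exact ⟨m * c, fun P h2 hsm hf => (poly_le_threshold c k m).trans_lt (hm P h2 hsm hf)⟩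

/-- `PerSmExpHard ⟹ PerNotSmVP`. [folklore] -/
theorem perNotSmVP_of_perSmExpHard (hA : PerSmExpHard) : PerNotSmVP := by
  obtain ⟨c, hc⟩ := hA
  exact perNotSmVP_of_perSmHardExp hc

/-- The gen-2 residual disjunct `SmLiftPer` (second disjunct of `DecompCycle1.TameOrSmLift`,
stmt-ValiantsHypothesis-23662: `VP = VNP ⟹ per ∈ smVP`, polynomial threshold) implies every rung `B_c`.
[folklore] -/
theorem smSubexpLift_of_polyLift (c : ℕ)
    (h : VP ℂ = VNP ℂ → ∃ k : ℕ, ∀ n : ℕ, ∃ P : ArithCircuit ℂ (Fin n × Fin n), P.IsFanInTwo ∧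
      IsSyntacticallyMultilinear P ∧ P.Computes (perPoly (Fin n) ℂ) ∧ P.size ≤ n ^ k + k) :
    SmSubexpLift c := by
  intro heq
  obtain ⟨k, hk⟩ := h heq
  refine ⟨c ^ k + k + 1, fun m => ?_⟩
  obtain ⟨P, h2, hsm, hf, hs⟩ := hk (m * c)
  exact ⟨P, h2, hsm, hf, hs.trans (poly_le_threshold c k m)⟩

/-- `B_c` is (vacuously) implied by `S`. [folklore] -/
theorem smSubexpLift_of_vh (c : ℕ) (hS : _root_.ValiantsHypothesis) : SmSubexpLift c := fun heq =>
  absurd heq (perNotPComputableComplex_iff_holds.mp (perNotPComputableComplex_iff_holds.mpr hS))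

/-! ## §4 The registered STRONGER statement: `MultilinearRyserOptimal ⟹ A_c` for `c ≥ 3` -/

/-- Growth: for every `K` there is `m ≥ K` with `(K (m+1)^K)² < 2^m` (witness `m + 1 = 2^t` with
`2 (t+1) (K+1) < 2^t`). [folklore] -/
theorem exists_sq_lt_two_pow (K : ℕ) : ∃ m : ℕ, K ≤ m ∧ (K * (m + 1) ^ K) ^ 2 < 2 ^ m := by
  -- first a `t` with `2 (t+1) (K+1) < 2^t`
  obtain ⟨t, ht⟩ : ∃ t : ℕ, 2 * (t + 1) * (K + 1) < 2 ^ t := by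
    refine ⟨3 * (K + 4), ?_⟩
    set u : ℕ := K + 4 with hu
    have hKu : K + 1 ≤ u := by omega
    have h3u : 3 ≤ u := by omega
    have hupow : u < 2 ^ u := Nat.lt_two_pow_self
    have h8 : 8 ≤ 2 ^ u :=
      calc (8 : ℕ) = 2 ^ 3 := by norm_num
        _ ≤ 2 ^ u := Nat.pow_le_pow_right (by norm_num) h3u
    have hsplit : 2 ^ (3 * u) = 2 ^ u * (2 ^ u * 2 ^ u) := by
      rw [← pow_add, ← pow_add]; ring_nf
    rw [hsplit]
    have huu : u * u < 2 ^ u * 2 ^ u := Nat.mul_lt_mul'' hupow hupow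
    calc 2 * (3 * u + 1) * (K + 1) ≤ 8 * (u * u) := by nlinarith [hKu, h3u]
      _ ≤ 2 ^ u * (u * u) := Nat.mul_le_mul_right _ h8
      _ < 2 ^ u * (2 ^ u * 2 ^ u) := Nat.mul_lt_mul_of_pos_left huu (by positivity)
  have h1t : 1 ≤ 2 ^ t := Nat.one_le_two_pow
  refine ⟨2 ^ t - 1, ?_, ?_⟩
  · have : K + 1 ≤ 2 ^ t := by nlinarith
    omega
  · rw [Nat.sub_add_cancel h1t]
    have hK : K ≤ 2 ^ K := (Nat.lt_two_pow_self).le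
    have hexp : 2 * K + 2 * (t * K) < 2 ^ t - 1 := by
      have : 2 * (t + 1) * (K + 1) = 2 * K + 2 * (t * K) + 2 * t + 2 := by ring
      omega
    calc (K * (2 ^ t) ^ K) ^ 2 ≤ (2 ^ K * (2 ^ t) ^ K) ^ 2 :=
          Nat.pow_le_pow_left (Nat.mul_le_mul_right _ hK) 2
      _ = 2 ^ (2 * K + 2 * (t * K)) := by
          rw [← pow_mul, ← pow_add, ← pow_mul]; ring_nf
      _ < 2 ^ (2 ^ t - 1) := Nat.pow_lt_pow_right (by norm_num) hexp

/-- `MultilinearRyserOptimal ⟹ A_c` for every `c ≥ 3`: `2^((1-1/6)·mc) ≥ 2^(5m/2) > a (m+1)^a 4^m`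
for the large `m` of `exists_sq_lt_two_pow`. [folklore] -/
theorem perSmHardExp_of_multilinearRyserOptimal {c : ℕ} (hc : 3 ≤ c)
    (h : MultilinearRyserOptimal) : PerSmHardExp c := by
  intro a
  obtain ⟨n₀, hn₀⟩ := h (1 / 6 : ℝ) (by norm_num)
  obtain ⟨m, hm, hgrow⟩ := exists_sq_lt_two_pow (max a n₀)
  refine ⟨m, fun P h2 hsm hf => ?_⟩
  have hn : n₀ ≤ m * c :=
    ((le_max_right a n₀).trans hm).trans (Nat.le_mul_of_pos_right m (by omega))
  have hsize := hn₀ (m * c) hn P ⟨h2, hsm, hf⟩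
  -- the polynomial factor
  set A : ℕ := a * (m + 1) ^ a with hA
  have hAle : A ≤ max a n₀ * (m + 1) ^ max a n₀ :=
    Nat.mul_le_mul (le_max_left a n₀) (Nat.pow_le_pow_right (Nat.succ_pos m) (le_max_left a n₀))
  have hA2 : A ^ 2 < 2 ^ m := lt_of_le_of_lt (Nat.pow_le_pow_left hAle 2) hgrow
  -- pass to ℝ
  have hA2R : ((A : ℝ)) ^ 2 < (2 : ℝ) ^ (m : ℝ) := by
    rw [Real.rpow_natCast]; exact_mod_cast hA2
  have hhalf : (A : ℝ) < (2 : ℝ) ^ ((m : ℝ) / 2) := by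
    have h0 : (0 : ℝ) ≤ (2 : ℝ) ^ ((m : ℝ) / 2) := by positivity
    refine lt_of_pow_lt_pow_left₀ 2 h0 ?_
    rwa [← Real.rpow_natCast ((2 : ℝ) ^ ((m : ℝ) / 2)) 2, ← Real.rpow_mul (by norm_num : (0:ℝ) ≤ 2),
      show (m : ℝ) / 2 * ((2 : ℕ) : ℝ) = (m : ℝ) by push_cast; ring]
  have hfour : ((4 ^ m : ℕ) : ℝ) = (2 : ℝ) ^ (2 * (m : ℝ)) := by
    rw [show (2 : ℝ) * (m : ℝ) = ((2 * m : ℕ) : ℝ) by push_cast; ring, Real.rpow_natCast]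
    push_cast
    rw [pow_mul]; norm_num
  have hexp : (m : ℝ) / 2 + 2 * (m : ℝ) ≤ (1 - 1 / 6) * ((m * c : ℕ) : ℝ) := by
    have hc' : (3 : ℝ) ≤ (c : ℝ) := by exact_mod_cast hc
    have hm0 : (0 : ℝ) ≤ (m : ℝ) := by positivity
    push_cast
    nlinarith
  have key : ((A * 4 ^ m : ℕ) : ℝ) < (2 : ℝ) ^ ((1 - 1 / 6) * ((m * c : ℕ) : ℝ)) := by
    have h4pos : (0 : ℝ) < ((4 ^ m : ℕ) : ℝ) := by positivity
    calc ((A * 4 ^ m : ℕ) : ℝ) = (A : ℝ) * ((4 ^ m : ℕ) : ℝ) := by push_cast; ring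
      _ < (2 : ℝ) ^ ((m : ℝ) / 2) * ((4 ^ m : ℕ) : ℝ) := mul_lt_mul_of_pos_right hhalf h4pos
      _ = (2 : ℝ) ^ ((m : ℝ) / 2 + 2 * (m : ℝ)) := by rw [hfour, Real.rpow_add two_pos]
      _ ≤ (2 : ℝ) ^ ((1 - 1 / 6) * ((m * c : ℕ) : ℝ)) :=
          Real.rpow_le_rpow_of_exponent_le one_le_two hexp
  have : ((A * 4 ^ m : ℕ) : ℝ) < (P.size : ℝ) := key.trans_le hsize
  exact_mod_cast this

/-- `MultilinearRyserOptimal ⟹ PerSmExpHard` (at `c = 3`). [folklore] -/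
theorem perSmExpHard_of_multilinearRyserOptimal (h : MultilinearRyserOptimal) : PerSmExpHard :=
  ⟨3, perSmHardExp_of_multilinearRyserOptimal le_rfl h⟩

/-! ## §5 The kernel link: `B_c` PROVED, hence `S ⟸ PerSmExpHard` and `S ⟸ MultilinearRyserOptimal` -/

/-- RUNG `B_c` PROVED for every `c` (kernel `exists_smCircuit_perPoly_of_VP_eq_VNP`).
[cite: LimayeSrinivasanTavenas2025, Lemma 12] -/
theorem smSubexpLift_holds (c : ℕ) : SmSubexpLift c :=
  Summit.ValiantsHypothesis.ValiantsHypothesis.Theorems.BlockLaplaceLift.exists_smCircuit_perPoly_of_VP_eq_VNP ℂ c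

/-- NODE OF RECORD (v3): `S ⟸ PerSmExpHard` — exponential syntactically-multilinear hardness of the
permanent at any one rate `4^(n/c)` implies `VP_ℂ ≠ VNP_ℂ`. [folklore] -/
theorem closes (hA : PerSmExpHard) : _root_.ValiantsHypothesis := by
  obtain ⟨c, hc⟩ := hA
  exact closes_at c hc (smSubexpLift_holds c)

/-- COROLLARY: the registered crux `RyserTripartition.MultilinearRyserOptimal`
(stmt-ValiantsHypothesis-7161: Ryser is optimal among syntactically multilinear circuits) implies
Valiant's hypothesis `VP_ℂ ≠ VNP_ℂ`. [folklore] -/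
theorem vh_of_multilinearRyserOptimal (h : MultilinearRyserOptimal) : _root_.ValiantsHypothesis :=
  closes (perSmExpHard_of_multilinearRyserOptimal h)

/-! ## §6 The low rungs are decided (rev 2): `A_0`, `A_1`, `A_2` are false -/

/-- `A_0` is false (degenerate rung: `per_0 = 1` has a circuit of size `≤ 2`). [folklore] -/
theorem not_perSmHardExp_zero : ¬ PerSmHardExp 0 := by
  intro h
  obtain ⟨m, hm⟩ := h 2
  obtain ⟨P, h2, hsm, hf, hs⟩ := ColumnSubsetDP.exists_smCircuit_perPoly_dp (R := ℂ) (m * 0)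
  have hlt := hm P h2 hsm hf
  have hs' : P.size ≤ 2 := by simpa using hs
  have h1 : 1 ≤ (m + 1) ^ 2 * 4 ^ m := Nat.one_le_iff_ne_zero.mpr (by positivity)
  have : 2 * 1 ≤ 2 * ((m + 1) ^ 2 * 4 ^ m) := Nat.mul_le_mul_left 2 h1
  have hmul : 2 * (m + 1) ^ 2 * 4 ^ m = 2 * ((m + 1) ^ 2 * 4 ^ m) := by ring
  omega

/-- `A_1` is false: the column-subset DP gives syntactically multilinear circuits for `per_m` of size
`2(m+1)2^m`. [cite: Ryser1963, Ch. 2 §5] -/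
theorem not_perSmHardExp_one : ¬ PerSmHardExp 1 := ColumnSubsetDP.not_perSmHardExp_one

/-- `A_2` is false: the column-subset DP gives syntactically multilinear circuits for `per_(2m)` of size
`2(2m+1)4^m`. [cite: Ryser1963, Ch. 2 §5] -/
theorem not_perSmHardExp_two : ¬ PerSmHardExp 2 := ColumnSubsetDP.not_perSmHardExp_two

/-- Hence the conjecture `PerSmExpHard` lives on the rungs `c ≥ 3` only (rates `2^((2/c) n) < 2^n`).
[folklore] -/
theorem perSmExpHard_iff_three_le : PerSmExpHard ↔ ∃ c : ℕ, 3 ≤ c ∧ PerSmHardExp c := by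
  constructor
  · rintro ⟨c, hc⟩
    refine ⟨c, ?_, hc⟩
    by_contra hlt
    have hlt : c < 3 := Nat.lt_of_not_le hlt
    interval_cases c
    · exact not_perSmHardExp_zero hc
    · exact not_perSmHardExp_one hc
    · exact not_perSmHardExp_two hc
  · rintro ⟨c, -, hc⟩
    exact ⟨c, hc⟩

/-! ## §7 The depth-3 / row-local slice of the dial is decided exactly at `θ = 2/3` (rev 3) -/

/-- PIECE `A^ΣΠ_c` — the ROW-LOCAL `ΣΠ` (depth-3) SLICE of `A_c`: along `n = mc`, every expression
`per_n = Σ_{t<s} ∏_i q_{t,i}` with ROW-LOCAL factors (`q_{t,i}` mentions only the row `i`; linear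
`q_{t,i}` = a row-set-multilinear `ΣΠΣ` circuit of top fan-in `s`) has `s > a·(m+1)^a·4^m`,
eventually, for every `a`. TAG: DECIDED — true iff `c ≥ 3` (`perRowLocalHardExp_iff_three_le`).
WEAKER than `A_c` and than `S`. [cite: NisanWigderson1996, Thm. 3.2 (method); Ryser1963, Ch. 2 Thm. 4.1] -/
def PerRowLocalHardExp (c : ℕ) : Prop :=
  ∀ a : ℕ, ∃ m : ℕ, ∀ (s : ℕ) (q : Fin s → Fin (m * c) → MvPolynomial (Fin (m * c) × Fin (m * c)) ℂ),
    (∀ t i, ∃ g : MvPolynomial (Fin (m * c)) ℂ, q t i = MvPolynomial.rename (Prod.mk i) g) →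
    perPoly (Fin (m * c)) ℂ = ∑ t, ∏ i, q t i → a * (m + 1) ^ a * 4 ^ m < s

/-- Threshold arithmetic at depth 3: for `c ≥ 3`, eventually `(mc+1)·a·(m+1)^a·4^m < 2^(mc)`. [folklore] -/
theorem threshold_mul_succ_lt_two_pow {c : ℕ} (hc : 3 ≤ c) (a : ℕ) :
    ∃ m : ℕ, (m * c + 1) * (a * (m + 1) ^ a * 4 ^ m) < 2 ^ (m * c) := by
  obtain ⟨m, -, hm⟩ := exists_sq_lt_two_pow (a + c + 1)
  refine ⟨m, ?_⟩
  set K := a + c + 1 with hK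
  have h1 : m * c + 1 ≤ K * (m + 1) := by nlinarith
  have h3 : (m + 1) ^ a * (m + 1) ≤ (m + 1) ^ K * (m + 1) ^ K := by
    rw [← pow_succ, ← pow_add]
    exact Nat.pow_le_pow_right (Nat.succ_pos m) (by omega)
  have hpoly : (m * c + 1) * (a * (m + 1) ^ a) ≤ (K * (m + 1) ^ K) ^ 2 := by
    calc (m * c + 1) * (a * (m + 1) ^ a) ≤ K * (m + 1) * (K * (m + 1) ^ a) :=
          Nat.mul_le_mul h1 (Nat.mul_le_mul_right _ (by omega))
      _ = K * K * ((m + 1) ^ a * (m + 1)) := by ring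
      _ ≤ K * K * ((m + 1) ^ K * (m + 1) ^ K) := Nat.mul_le_mul_left _ h3
      _ = (K * (m + 1) ^ K) ^ 2 := by ring
  have h8 : 2 ^ m * 4 ^ m ≤ 2 ^ (m * c) := by
    rw [← mul_pow, show (2 * 4 : ℕ) = 2 ^ 3 by norm_num, ← pow_mul,
      pow_le_pow_iff_right₀ (by norm_num : 1 < 2)]
    nlinarith
  calc (m * c + 1) * (a * (m + 1) ^ a * 4 ^ m) = (m * c + 1) * (a * (m + 1) ^ a) * 4 ^ m := by ring
    _ < 2 ^ m * 4 ^ m := Nat.mul_lt_mul_of_lt_of_le (lt_of_le_of_lt hpoly hm) le_rfl (by positivity)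
    _ ≤ 2 ^ (m * c) := h8

/-- **`A^ΣΠ_c` holds for `c ≥ 3`** (flattening rank `2^n ≤ (n+1)·s`). [cite: NisanWigderson1996, Thm. 3.2 (method)] -/
theorem perRowLocalHardExp {c : ℕ} (hc : 3 ≤ c) : PerRowLocalHardExp c := by
  intro a
  obtain ⟨m, hm⟩ := threshold_mul_succ_lt_two_pow hc a
  refine ⟨m, fun s q hq h => ?_⟩
  have hlb : 2 ^ (m * c) ≤ (m * c + 1) * s :=
    RowPartitionRank.two_pow_le_succ_mul_of_rowLocal _ s q hq h
  by_contra hs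
  exact absurd (hm.trans_le (hlb.trans (Nat.mul_le_mul_left _ (Nat.le_of_not_lt hs)))) (lt_irrefl _)

/-- **`A^ΣΠ_c` fails for `c ≤ 2`** (Ryser's formula: `2^n` products of row-local linear forms).
[cite: Ryser1963, Ch. 2 Thm. 4.1] -/
theorem not_perRowLocalHardExp {c : ℕ} (hc : c ≤ 2) : ¬ PerRowLocalHardExp c := by
  intro h
  obtain ⟨m, hm⟩ := h 1
  obtain ⟨q, hq, hper⟩ := RyserFormula.exists_rowLocal_repr_perPoly (R := ℂ) (m * c)
  have hlt := hm (2 ^ (m * c)) q hq hper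
  have hle : 2 ^ (m * c) ≤ 4 ^ m := by
    rw [show (4 : ℕ) = 2 ^ 2 by norm_num, ← pow_mul, pow_le_pow_iff_right₀ (by norm_num : 1 < 2)]
    nlinarith
  have : 4 ^ m ≤ 1 * (m + 1) ^ 1 * 4 ^ m := by
    rw [one_mul, pow_one]; exact Nat.le_mul_of_pos_left _ (Nat.succ_pos m)
  omega

/-- **The depth-3 dial is decided at `θ = 2/3`:** `A^ΣΠ_c ↔ c ≥ 3`. [cite: NisanWigderson1996, Thm. 3.2 (method); Ryser1963, Ch. 2 Thm. 4.1] -/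
theorem perRowLocalHardExp_iff_three_le {c : ℕ} : PerRowLocalHardExp c ↔ 3 ≤ c :=
  ⟨fun h => by by_contra hc; exact not_perRowLocalHardExp (by omega) h, perRowLocalHardExp⟩

/-- **Depth 4 ⟹ depth 3**: the depth-4 row-sml rung implies `A^ΣΠ_c`. [folklore] -/
theorem perRowLocalHardExp_of_depthFour {c : ℕ} (h : RowSmlDepthFour.PerRowSmlDepthFourHardExp c) :
    PerRowLocalHardExp c := fun a => RowSmlDepthFour.rowLocal_hard_of_depthFour h a

/-- Hence the depth-4 rung, too, lives on `c ≥ 3` only. [cite: Ryser1963, Ch. 2 Thm. 4.1] -/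
theorem three_le_of_perRowSmlDepthFourHardExp {c : ℕ} (h : RowSmlDepthFour.PerRowSmlDepthFourHardExp c) :
    3 ≤ c :=
  perRowLocalHardExp_iff_three_le.mp (perRowLocalHardExp_of_depthFour h)

end Summit.ValiantsHypothesis.ValiantsHypothesis.Theorems.SmThreshold
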